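import Literature.InformationTheory.QuantumCodes.MinWeightDecodingClusters
import Mathlib.Algebra.Module.Equiv.Basic
import Mathlib.Algebra.Module.Submodule.Map
import HarnessLib

/-!
# Failure of minimum-weight decoding forces a dense connected cluster — arbitrary finite index types

Topic `Literature/InformationTheory/QuantumCodes` (venture QEC, LADDER-QEC rung Q5). The coding half of
the Kovalev–Pryadko / Gottesman cluster-counting threshold theorem,
`exists_denseCluster_of_minWeight_failure` of `MinWeightDecodingClusters.lean` (qec-lit-2), is stated
there for `Fin`-indexed check matrices `H : Matrix (Fin m) (Fin n) (ZMod 2)` (it rests on the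
`Fin`-indexed restriction API of `LinkedCluster.lean`). This theorem-only file TRANSPORTS it to
arbitrary finite index types `C` (checks) and `V` (qubits) along `Fintype.equivFin` — nothing is
re-proved, nothing restated: reindex the matrix (`Matrix.submatrix`), the vectors
(`LinearEquiv.funCongrLeft`) and the trivial-error subspace (`Submodule.map`), apply the `Fin` theorem,
and pull the connected cluster back (`checkGraph` adjacency, `IsGraphConnected`, supports and
cardinalities are invariant under relabelling). Consumers: the toric code indexed by
`TorusSite 2 L × Fin 2` (gen-0 ported the argument by hand in `ToricCodeClusters.lean`) and the
space-time histories `HistoryLoc (Edge L) (Vertex L) T` of the phenomenological model.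

## References

* [Gottesman2014] D. Gottesman, *Fault-tolerant quantum computation with constant overhead*, Quantum
  Inf. Comput. 14 (2014) 1338, §4 Thm. 3 (proof, first claim).
* [KovalevPryadko2013] A. A. Kovalev, L. P. Pryadko, Phys. Rev. A 87 (2013) 020304(R), Thm. 3.
-/

namespace Literature.InformationTheory.QuantumCodes

open Finset Matrix
open Literature.Probability.LatticeModels

section Transport

variable {C V : Type*} {m n : ℕ}

/-- Relabelling the coordinates does not change the Hamming weight. [folklore] -/
private theorem hammingNorm_comp_finEquiv [Fintype V] (x : V → ZMod 2) (e : Fin n ≃ V) :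
    hammingNorm (x ∘ e) = hammingNorm x := by
  unfold hammingNorm
  refine Finset.card_equiv e (fun i => ?_)
  simp

/-- Reindexing a check matrix relabels its check graph: `i ~ j` in `checkGraph (H.submatrix f e)` iff
`e i ~ e j` in `checkGraph H` (for a surjective row relabelling `f`).
[cite: Gottesman2014, §4 (adjacency graph of the code)] -/
theorem checkGraph_submatrix_adj (H : Matrix C V (ZMod 2)) (f : Fin m ≃ C) (e : Fin n ≃ V)
    (i j : Fin n) :
    (checkGraph (H.submatrix f e)).Adj i j ↔ (checkGraph H).Adj (e i) (e j) := by
  simp only [checkGraph, Matrix.submatrix_apply, ne_eq, EmbeddingLike.apply_eq_iff_eq]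
  constructor
  · rintro ⟨hne, r, hr⟩
    exact ⟨hne, f r, hr⟩
  · rintro ⟨hne, r, hr⟩
    refine ⟨hne, f.symm r, ?_⟩
    simpa using hr

/-- Connected vertex sets of the relabelled check graph pull back to connected vertex sets.
[cite: Gottesman2014, §4 (clusters of the adjacency graph)] -/
theorem isGraphConnected_map_of_submatrix [DecidableEq V] (H : Matrix C V (ZMod 2)) (f : Fin m ≃ C)
    (e : Fin n ≃ V)
    {S : Finset (Fin n)} (hS : IsGraphConnected (checkGraph (H.submatrix f e)) S) :
    IsGraphConnected (checkGraph H) (S.map e.toEmbedding) := by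
  intro A hA hAne hBne
  -- pull `A` back to `Fin n`
  set A' : Finset (Fin n) := S.filter fun i => e i ∈ A with hA'
  have hA'sub : A' ⊆ S := Finset.filter_subset _ _
  have hA'ne : A'.Nonempty := by
    obtain ⟨a, ha⟩ := hAne
    obtain ⟨i, hi, rfl⟩ := Finset.mem_map.1 (hA ha)
    exact ⟨i, Finset.mem_filter.2 ⟨hi, ha⟩⟩
  have hB'ne : (S \ A').Nonempty := by
    obtain ⟨b, hb⟩ := hBne
    rw [Finset.mem_sdiff] at hb
    obtain ⟨i, hi, rfl⟩ := Finset.mem_map.1 hb.1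
    refine ⟨i, Finset.mem_sdiff.2 ⟨hi, fun h => hb.2 (Finset.mem_filter.1 h).2⟩⟩
  obtain ⟨a, ha, b, hb, hadj⟩ := hS A' hA'sub hA'ne hB'ne
  refine ⟨e a, (Finset.mem_filter.1 ha).2, e b, ?_, (checkGraph_submatrix_adj H f e a b).1 hadj⟩
  rw [Finset.mem_sdiff] at hb ⊢
  refine ⟨Finset.mem_map.2 ⟨b, hb.1, rfl⟩, fun h => hb.2 (Finset.mem_filter.2 ⟨hb.1, h⟩)⟩

/-- Reindexed matrix times relabelled vector = relabelled product.
[folklore] -/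
private theorem submatrix_mulVec_comp [Fintype V] (H : Matrix C V (ZMod 2)) (f : Fin m ≃ C) (e : Fin n ≃ V)
    (x : V → ZMod 2) : H.submatrix f e *ᵥ (x ∘ e) = (H *ᵥ x) ∘ f := by
  rw [Matrix.submatrix_mulVec_equiv]
  congr 2
  funext v
  simp

end Transport

/-! ### The dense-cluster theorem for arbitrary finite index types -/

/-- **Failure of minimum-weight decoding forces a dense connected cluster** — the theorem
`exists_denseCluster_of_minWeight_failure` for an arbitrary finite check index `C` and qubit index
`V`: if every zero-syndrome vector outside the trivial-error subspace `SX` has weight `≥ d`, `e'` is a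
minimum-weight vector with the syndrome of `e`, and `e + e' ∉ SX`, then some `checkGraph H`-connected
`S` has `d ≤ |S| ≤ 2 |S ∩ supp e|`. Proved by transport to `Fin`-indices (`Fintype.equivFin`).
[cite: Gottesman2014, Thm 3 (proof, first claim)] -/
theorem exists_denseCluster_of_minWeight_failure' {C V : Type*} [Fintype C] [Fintype V]
    [DecidableEq V] (H : Matrix C V (ZMod 2)) (SX : Submodule (ZMod 2) (V → ZMod 2)) {d : ℕ}
    (hd : ∀ x : V → ZMod 2, H *ᵥ x = 0 → x ∉ SX → d ≤ hammingNorm x)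
    {e e' : V → ZMod 2} (hsyn : H *ᵥ e' = H *ᵥ e)
    (hmin : ∀ x : V → ZMod 2, H *ᵥ x = H *ᵥ e → hammingNorm e' ≤ hammingNorm x)
    (hfail : e + e' ∉ SX) :
    ∃ S : Finset V, IsGraphConnected (checkGraph H) S ∧ d ≤ S.card ∧
      S.card ≤ 2 * (S ∩ supp e).card := by
  classical
  -- relabel qubits and checks by `Fin`
  set eV : Fin (Fintype.card V) ≃ V := (Fintype.equivFin V).symm with heV
  set eC : Fin (Fintype.card C) ≃ C := (Fintype.equivFin C).symm with heC
  set H' : Matrix (Fin (Fintype.card C)) (Fin (Fintype.card V)) (ZMod 2) := H.submatrix eC eV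
    with hH'
  -- the relabelling of vectors, as a linear equivalence, and the transported subspace
  set φ : (V → ZMod 2) ≃ₗ[ZMod 2] (Fin (Fintype.card V) → ZMod 2) :=
    LinearEquiv.funCongrLeft (ZMod 2) (ZMod 2) eV with hφ
  have hφapp : ∀ x : V → ZMod 2, φ x = x ∘ eV := fun x => rfl
  set SX' : Submodule (ZMod 2) (Fin (Fintype.card V) → ZMod 2) := Submodule.map φ.toLinearMap SX
    with hSX'
  have hmemSX' : ∀ x : V → ZMod 2, x ∘ eV ∈ SX' ↔ x ∈ SX := by
    intro x
    rw [← hφapp, hSX']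
    constructor
    · intro h
      obtain ⟨y, hy, hyx⟩ := Submodule.mem_map.1 h
      have : y = x := φ.injective (by simpa using hyx)
      rwa [this] at hy
    · intro h
      exact Submodule.mem_map.2 ⟨x, h, rfl⟩
  -- every vector of `Fin n → ZMod 2` is a relabelled vector
  have hsurj : ∀ x' : Fin (Fintype.card V) → ZMod 2, ∃ x : V → ZMod 2, x' = x ∘ eV := fun x' =>
    ⟨x' ∘ eV.symm, by funext i; simp⟩
  have hmul : ∀ x : V → ZMod 2, H' *ᵥ (x ∘ eV) = (H *ᵥ x) ∘ eC := fun x =>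
    submatrix_mulVec_comp H eC eV x
  have hcancel : ∀ y z : C → ZMod 2, y ∘ eC = z ∘ eC → y = z := by
    intro y z h
    funext c
    have := congrFun h (eC.symm c)
    simpa using this
  -- transported hypotheses
  have hd' : ∀ x' : Fin (Fintype.card V) → ZMod 2, H' *ᵥ x' = 0 → x' ∉ SX' → d ≤ hammingNorm x' := by
    intro x' hx' hxS
    obtain ⟨x, rfl⟩ := hsurj x'
    rw [hammingNorm_comp_finEquiv]
    refine hd x ?_ (fun h => hxS ((hmemSX' x).2 h))
    rw [hmul] at hx'
    exact hcancel _ _ (by rw [hx']; rfl)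
  have hsyn' : H' *ᵥ (e' ∘ eV) = H' *ᵥ (e ∘ eV) := by rw [hmul, hmul, hsyn]
  have hmin' : ∀ x' : Fin (Fintype.card V) → ZMod 2, H' *ᵥ x' = H' *ᵥ (e ∘ eV) →
      hammingNorm (e' ∘ eV) ≤ hammingNorm x' := by
    intro x' hx'
    obtain ⟨x, rfl⟩ := hsurj x'
    rw [hammingNorm_comp_finEquiv, hammingNorm_comp_finEquiv]
    rw [hmul, hmul] at hx'
    exact hmin x (hcancel _ _ hx')
  have hfail' : e ∘ eV + e' ∘ eV ∉ SX' := by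
    have : e ∘ eV + e' ∘ eV = (e + e') ∘ eV := rfl
    rw [this, hmemSX']
    exact hfail
  obtain ⟨S', hconn', hd'le, hS'half⟩ :=
    exists_denseCluster_of_minWeight_failure H' SX' hd' hsyn' hmin' hfail'
  -- pull the cluster back to `V`
  refine ⟨S'.map eV.toEmbedding, isGraphConnected_map_of_submatrix H eC eV hconn', ?_, ?_⟩
  · rwa [Finset.card_map]
  · rw [Finset.card_map]
    have hinter : (S'.map eV.toEmbedding ∩ supp e) = (S' ∩ supp (e ∘ eV)).map eV.toEmbedding := by
      ext v
      simp only [Finset.mem_inter, Finset.mem_map, Equiv.coe_toEmbedding, supp, Finset.mem_filter,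
        Finset.mem_univ, true_and, Function.comp_apply]
      constructor
      · rintro ⟨⟨i, hi, rfl⟩, hv⟩
        exact ⟨i, ⟨hi, hv⟩, rfl⟩
      · rintro ⟨i, ⟨hi, hv⟩, rfl⟩
        exact ⟨⟨i, hi, rfl⟩, hv⟩
    rw [hinter, Finset.card_map]
    exact hS'half

end Literature.InformationTheory.QuantumCodes
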